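import Literature.MathematicalPhysics.StatisticalMechanics.BarlowStackingEnergy
import Summits.AtomisticToContinuum.Crystallization.Theorems.PricedLinkCensusSoftLayerPropagationBasics

/-!
# Crux `PeriodicWindows` (stmt-AtomisticToContinuum-3240), line `Sketch` — stub E2a, part 1: geometry of Barlow stackings

Helper file for the registered stub `stub_shapeStationarity` (E2a) of the lead skeleton `PeriodicWindowsSketch`
(rev 9, route `ChessboardParticlePlanes`). Elementary geometry of the rotated Barlow stackings
`A '' barlowStacking a h s` (`BarlowStacking.lean`) at GENERAL parameters `a, h > 0`:

* `shp_dist_barlowPos_smul` — distances of `barlowPos a (a c) s …` are `a` times those of `barlowPos 1 c s …`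
  (from `barlowPos_eq_smul` of `PricedLinkCensusSoftLayerPropagationBasics`);
* `shp_abs_haggLabel_sub_le` — the label walk of a Hägg sequence is `1`-Lipschitz;
* `shp_norm_layerVec_ge` — index-to-position is co-Lipschitz: `(min a h / 8) · max(|Δk|, |Δi|, |Δj|) ≤ ‖layerVec a h ΔL Δk Δi Δj‖`
  whenever `|ΔL| ≤ |Δk|`;
* `shp_param_injective`, `shp_range_param` — the parametrisation `(k,i,j) ↦ A (barlowPos a h s k i j)` is injective
  with range `A '' barlowStacking a h s`.

All `[folklore]`.
-/

noncomputable section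

namespace Summit.AtomisticToContinuum.Crystallization.Theorems.PeriodicWindowsSketch

open Literature.MathematicalPhysics.StatisticalMechanics

/-! ## Homogeneity (the pointwise scaling `barlowPos_eq_smul` is in `PricedLinkCensusSoftLayerPropagationBasics`) -/

/-- Distances scale: `dist (barlowPos a (ac) …) (barlowPos a (ac) …) = a · dist (barlowPos 1 c …) (barlowPos 1 c …)`
for `a ≥ 0`. [folklore] -/
theorem shp_dist_barlowPos_smul {a : ℝ} (ha : 0 ≤ a) (c : ℝ) (s : ℤ → ℤ) (k i j k' i' j' : ℤ) :
    dist (barlowPos a (a * c) s k i j) (barlowPos a (a * c) s k' i' j') =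
      a * dist (barlowPos 1 c s k i j) (barlowPos 1 c s k' i' j') := by
  rw [barlowPos_eq_smul, barlowPos_eq_smul, dist_smul₀, Real.norm_eq_abs, abs_of_nonneg ha]

/-! ## The label walk is 1-Lipschitz -/

/-- `|L(k + n) − L(k)| ≤ n` for a Hägg sequence. [folklore] -/
theorem shp_abs_haggLabel_add_sub_le {s : ℤ → ℤ} (hs : IsHaggSeq s) (k : ℤ) (n : ℕ) :
    |haggLabel s (k + n) - haggLabel s k| ≤ n := by
  induction n with
  | zero => simp
  | succ n ih =>
    have hstep : haggLabel s (k + (n + 1 : ℕ)) = haggLabel s (k + n) + s (k + n) := by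
      rw [show (k + (n + 1 : ℕ) : ℤ) = k + n + 1 by push_cast; ring, haggLabel_succ]
    have hs1 : |s (k + n)| ≤ 1 := by
      rcases hs (k + n) with h | h <;> simp [h]
    rw [hstep]
    calc |haggLabel s (k + ↑n) + s (k + ↑n) - haggLabel s k|
        = |(haggLabel s (k + ↑n) - haggLabel s k) + s (k + ↑n)| := by ring_nf
      _ ≤ |haggLabel s (k + ↑n) - haggLabel s k| + |s (k + ↑n)| := abs_add_le _ _
      _ ≤ n + 1 := add_le_add ih hs1
      _ = (n + 1 : ℕ) := by push_cast; ring

/-- **The label walk is 1-Lipschitz**: `|L(k') − L(k)| ≤ |k' − k|`. [folklore] -/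
theorem shp_abs_haggLabel_sub_le {s : ℤ → ℤ} (hs : IsHaggSeq s) (k k' : ℤ) :
    |haggLabel s k' - haggLabel s k| ≤ |k' - k| := by
  rcases le_total k k' with hle | hle
  · obtain ⟨n, hn⟩ := Int.eq_ofNat_of_zero_le (sub_nonneg.2 hle)
    have hk' : k' = k + n := by linarith
    have habs : |k' - k| = (n : ℤ) := by rw [hn, Nat.abs_cast]
    rw [habs, hk']
    exact shp_abs_haggLabel_add_sub_le hs k n
  · obtain ⟨n, hn⟩ := Int.eq_ofNat_of_zero_le (sub_nonneg.2 hle)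
    have hk : k = k' + n := by linarith
    have habs : |k' - k| = (n : ℤ) := by rw [abs_sub_comm, hn, Nat.abs_cast]
    rw [habs, abs_sub_comm, hk]
    exact shp_abs_haggLabel_add_sub_le hs k' n

/-! ## Index-to-position is co-Lipschitz -/

/-- **Co-Lipschitz bound.** For integers with `|ΔL| ≤ |Δk|`:
`(min a h / 8) · max(|Δk|, |Δi|, |Δj|) ≤ ‖layerVec a h ΔL Δk Δi Δj‖` (`a, h ≥ 0`). Cases: a large layer offset is
seen by the height coordinate; otherwise a large `|Δj|` by the second and a large `|Δi|` by the first coordinate.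
[folklore] -/
theorem shp_norm_layerVec_ge {a h : ℝ} (ha : 0 ≤ a) (hh : 0 ≤ h) {dL dk di dj : ℤ} (hL : |dL| ≤ |dk|) :
    min a h / 8 * max (|(dk : ℝ)|) (max |(di : ℝ)| |(dj : ℝ)|) ≤ ‖layerVec a h dL dk di dj‖ := by
  have hL' : |(dL : ℝ)| ≤ |(dk : ℝ)| := by exact_mod_cast hL
  set d : ℝ := max (|(dk : ℝ)|) (max |(di : ℝ)| |(dj : ℝ)|) with hd
  have hd0 : 0 ≤ d := le_max_of_le_left (abs_nonneg _)
  have hmin0 : 0 ≤ min a h := le_min ha hh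
  -- coordinate bounds
  have habs : ∀ i : Fin 3, |layerVec a h dL dk di dj i| ≤ ‖layerVec a h dL dk di dj‖ := fun i => by
    simpa using PiLp.norm_apply_le (layerVec a h dL dk di dj) i
  have h2 : |(dk : ℝ)| * h ≤ ‖layerVec a h dL dk di dj‖ := by
    have := habs 2
    rw [layerVec_apply_two, abs_mul, abs_of_nonneg hh] at this
    exact this
  have h1 : a * (Real.sqrt 3 / 2) * |(dj : ℝ) + dL / 3| ≤ ‖layerVec a h dL dk di dj‖ := by
    have := habs 1
    rw [layerVec_apply_one] at this
    have e : |a * Real.sqrt 3 / 2 * ((dj : ℝ) + dL / 3)| = a * (Real.sqrt 3 / 2) * |(dj : ℝ) + dL / 3| := by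
      rw [abs_mul, abs_of_nonneg (by positivity)]; ring
    rwa [e] at this
  have h0 : a * |(di : ℝ) + dj / 2 + dL / 2| ≤ ‖layerVec a h dL dk di dj‖ := by
    have := habs 0
    rw [layerVec_apply_zero, abs_mul, abs_of_nonneg ha] at this
    exact this
  have hsqrt : (1 : ℝ) ≤ Real.sqrt 3 := by
    rw [show (1 : ℝ) = Real.sqrt 1 by simp]
    exact Real.sqrt_le_sqrt (by norm_num)
  -- case analysis
  by_cases hk : d ≤ 4 * |(dk : ℝ)|
  · -- the height coordinate sees it
    calc min a h / 8 * d ≤ h / 8 * (4 * |(dk : ℝ)|) :=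
          mul_le_mul (div_le_div_of_nonneg_right (min_le_right _ _) (by norm_num)) hk hd0 (by positivity)
      _ = |(dk : ℝ)| * h / 2 := by ring
      _ ≤ |(dk : ℝ)| * h := by linarith [mul_nonneg (abs_nonneg (dk : ℝ)) hh]
      _ ≤ _ := h2
  · push Not at hk
    have hdk : |(dk : ℝ)| < d / 4 := by linarith
    have hdL : |(dL : ℝ)| < d / 4 := hL'.trans_lt hdk
    have hdij : d = max |(di : ℝ)| |(dj : ℝ)| := by
      rw [hd]
      refine max_eq_right ?_
      by_contra hcon
      push Not at hcon
      have : d = |(dk : ℝ)| := by rw [hd]; exact max_eq_left hcon.le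
      linarith [abs_nonneg (dk : ℝ)]
    by_cases hj : d ≤ 2 * |(dj : ℝ)|
    · -- the second coordinate sees it
      have hin : 5 / 12 * d ≤ |(dj : ℝ) + dL / 3| := by
        have := abs_sub_abs_le_abs_sub (dj : ℝ) (-(dL / 3 : ℝ))
        rw [sub_neg_eq_add, abs_neg, abs_div, abs_of_pos (by norm_num : (0:ℝ) < 3)] at this
        linarith
      calc min a h / 8 * d ≤ a / 8 * d :=
            mul_le_mul_of_nonneg_right (div_le_div_of_nonneg_right (min_le_left _ _) (by norm_num)) hd0
        _ ≤ a * (Real.sqrt 3 / 2) * (5 / 12 * d) := by nlinarith [mul_nonneg ha hd0]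
        _ ≤ a * (Real.sqrt 3 / 2) * |(dj : ℝ) + dL / 3| := by
            exact mul_le_mul_of_nonneg_left hin (by positivity)
        _ ≤ _ := h1
    · -- the first coordinate sees it
      push Not at hj
      have hdj : |(dj : ℝ)| < d / 2 := by linarith
      have hdi : d = |(di : ℝ)| := by
        rw [hdij]
        refine max_eq_left ?_
        by_contra hcon; push Not at hcon
        have : d = |(dj : ℝ)| := by rw [hdij]; exact max_eq_right hcon.le
        linarith [abs_nonneg (dj : ℝ)]
      have hin : 5 / 8 * d ≤ |(di : ℝ) + dj / 2 + dL / 2| := by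
        have h3 := abs_add_le ((di : ℝ) + dj / 2 + dL / 2) (-(dj / 2 + dL / 2 : ℝ))
        rw [show (di : ℝ) + dj / 2 + dL / 2 + -(dj / 2 + dL / 2 : ℝ) = di by ring, abs_neg] at h3
        have h4 : |(dj / 2 + dL / 2 : ℝ)| ≤ |(dj : ℝ)| / 2 + |(dL : ℝ)| / 2 := by
          calc |(dj / 2 + dL / 2 : ℝ)| ≤ |(dj / 2 : ℝ)| + |(dL / 2 : ℝ)| := abs_add_le _ _
            _ = |(dj : ℝ)| / 2 + |(dL : ℝ)| / 2 := by rw [abs_div, abs_div, abs_two]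
        linarith
      calc min a h / 8 * d ≤ a / 8 * d :=
            mul_le_mul_of_nonneg_right (div_le_div_of_nonneg_right (min_le_left _ _) (by norm_num)) hd0
        _ ≤ a * (5 / 8 * d) := by nlinarith [mul_nonneg ha hd0]
        _ ≤ a * |(di : ℝ) + dj / 2 + dL / 2| := mul_le_mul_of_nonneg_left hin ha
        _ ≤ _ := h0

/-! ## The parametrisation of a rotated stacking -/

/-- **Injectivity of the parametrisation** `(k, i, j) ↦ A (barlowPos a h s k i j)` for `a, h > 0`. [folklore] -/
theorem shp_param_injective {a h : ℝ} (ha : 0 < a) (hh : 0 < h) (s : ℤ → ℤ) (A : EuclideanSpace ℝ (Fin 3) →ₗᵢ[ℝ] EuclideanSpace ℝ (Fin 3)) :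
    Function.Injective fun t : ℤ × ℤ × ℤ => A (barlowPos a h s t.1 t.2.1 t.2.2) := by
  rintro ⟨k, i, j⟩ ⟨k', i', j'⟩ hAt
  have heq : barlowPos a h s k i j = barlowPos a h s k' i' j' := A.injective hAt
  by_contra hne
  have hne' : ((k, i, j) : ℤ × ℤ × ℤ) ≠ (k', i', j') := hne
  have hle := le_dist_barlowPos a h s ha.le hh.le hne'
  rw [heq, dist_self] at hle
  exact absurd hle (not_le.2 (lt_min ha hh))

/-- **Range of the parametrisation**: `A '' barlowStacking a h s`. [folklore] -/
theorem shp_range_param (a h : ℝ) (s : ℤ → ℤ) (A : EuclideanSpace ℝ (Fin 3) →ₗᵢ[ℝ] EuclideanSpace ℝ (Fin 3)) :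
    Set.range (fun t : ℤ × ℤ × ℤ => A (barlowPos a h s t.1 t.2.1 t.2.2)) = A '' barlowStacking a h s := by
  ext p
  simp only [Set.mem_range, Set.mem_image, mem_barlowStacking_iff]
  constructor
  · rintro ⟨⟨k, i, j⟩, rfl⟩
    exact ⟨_, ⟨k, i, j, rfl⟩, rfl⟩
  · rintro ⟨q, ⟨k, i, j, rfl⟩, rfl⟩
    exact ⟨(k, i, j), rfl⟩

/-- Separation of a rotated stacking: distinct points are at distance `≥ min a h`. [folklore] -/
theorem shp_sep_image {a h : ℝ} (ha : 0 ≤ a) (hh : 0 ≤ h) (s : ℤ → ℤ) (A : EuclideanSpace ℝ (Fin 3) →ₗᵢ[ℝ] EuclideanSpace ℝ (Fin 3)) :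
    ∀ p ∈ A '' barlowStacking a h s, ∀ q ∈ A '' barlowStacking a h s, p ≠ q → min a h ≤ dist p q := by
  rintro p ⟨p', hp', rfl⟩ q ⟨q', hq', rfl⟩ hpq
  rw [LinearIsometry.dist_map]
  exact le_dist_of_mem_barlowStacking a h s ha hh hp' hq' fun h' => hpq (by rw [h'])

/-- Distances in the stacking from a base point of layer `m`: a `layerVec` with label offset dominated by the
layer offset (the label walk is 1-Lipschitz), hence the co-Lipschitz bound applies:
`(min a h / 8) · max(|k − m|, |i|, |j|) ≤ dist (barlowPos a h s m 0 0) (barlowPos a h s k i j)`. [folklore] -/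
theorem shp_dist_barlowPos_ge {a h : ℝ} (ha : 0 ≤ a) (hh : 0 ≤ h) {s : ℤ → ℤ} (hs : IsHaggSeq s)
    (m k i j : ℤ) :
    min a h / 8 * max (|((k - m : ℤ) : ℝ)|) (max |(i : ℝ)| |(j : ℝ)|) ≤
      dist (barlowPos a h s m 0 0) (barlowPos a h s k i j) := by
  rw [dist_barlowPos_eq_norm_layerVec, sub_zero, sub_zero]
  exact shp_norm_layerVec_ge ha hh (shp_abs_haggLabel_sub_le hs m k)

end Summit.AtomisticToContinuum.Crystallization.Theorems.PeriodicWindowsSketch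

end
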